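import Summits.PneNP.PneNP.Theorems.KarlinRubinMonotoneBlindDepth3Witness
import Summits.PneNP.PneNP.Theorems.KarlinRubinMonotoneBlindDepth3Encoding

/-!
# Route KarlinRubin, crux `MonotoneBlind` (stmt-PneNP-18027): depth 3 — resampling the inside of the planted set

Step 3 of the depth-3 rescue lemma (seat write-up `MonotoneBlind_depth3_theorem.md`). Fix a planted set `A`, a
clause family `𝓒`, a threshold `t`, a bound `r` and a target `m'` with `m' r ≤ t + r`. A clause *needs rescue* for
`x` if it has no on-slot of `x` outside `A`. Events (all written inline):

* `H_t(A,x)`: the CNF of `𝓒` accepts `plant A x` and every transversal inside `plant A x` has `> t` slots inside `A`;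
* `G(A,x)`: every clause needing rescue has `≤ r` slots inside `A`;
* `E'(A,x)`: the CNF accepts `plant A x` and some `m'` clauses of `𝓒` are entirely OFF in `x` with pairwise
  disjoint inside-`A` parts.

* `depth3_resample_count` — `#{x : H_t ∧ G} ≤ 2^{m' r} · #{x : E'}`: both `H_t` and `G` only depend on `x` off the
  slots inside `A`; in each fibre, switching OFF the `≤ m' r` inside slots of the `m'` disjoint parts given by
  `depth3_disjoint_parts` lands in `E'`, and at most `2^{m' r}` inputs of the fibre have the same image;
* `depth3_exists_minimal_of_white_parts` — on `E'(A,x)`, with `𝒲` the clauses of `𝓒` that are off in `x`: `A` is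
  touching and contains a minimal touching set of size `≥ z₀` whenever `C(z₀ - 1, 2) < m'`
  (`depth3_choose_card_ge_of_disjoint_parts`).

All `--supports stmt-PneNP-18027`; no definitions.
-/

set_option linter.dupNamespace false -- `Summit.PneNP.PneNP.…`: summit = sub-problem (D-0017)

namespace Summit.PneNP.PneNP.Theorems

open Finset
open Literature.Computability.Complexity
open Literature.Probability.RandomGraphs.PlantedClique

variable {n : ℕ}

/-! ### Erasing the inside of `A` -/

/-- Planting after switching off slots inside `A` changes nothing. [folklore] -/
theorem plant_eq_of_eq_off_inside (A : Finset (Fin n)) {x x' : EdgeVec n}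
    (h : ∀ e : (⊤ : SimpleGraph (Fin n)).edgeSet, (¬ ∀ v ∈ (e : Sym2 (Fin n)), v ∈ A) → x e = x' e) :
    plant A x = plant A x' := by
  funext e
  by_cases he : ∀ v ∈ (e : Sym2 (Fin n)), v ∈ A
  · rw [plant_apply_of_inside A x e he, plant_apply_of_inside A x' e he]
  · rw [plant_apply_of_not_inside A x e he, plant_apply_of_not_inside A x' e he, h e he]

/-! ### The resampling count -/

open Classical in
/-- **Resampling the inside of the planted set (counting form).** With `m' r ≤ t + r`:
`#{x : H_t(A,x) ∧ G(A,x)} ≤ 2^{m' r} · #{x : E'(A,x)}` (see the module docstring for the three events). [folklore] -/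
theorem depth3_resample_count (A : Finset (Fin n)) (𝓒 : Finset (Finset (⊤ : SimpleGraph (Fin n)).edgeSet))
    (t r m' : ℕ) (hmr : m' * r ≤ t + r) :
    #(univ.filter fun x : EdgeVec n =>
        ((∀ S ∈ 𝓒, ∃ e ∈ S, plant A x e = true) ∧
          ∀ T : Finset (⊤ : SimpleGraph (Fin n)).edgeSet, (∀ S ∈ 𝓒, ∃ e ∈ S, e ∈ T) →
            (∀ e ∈ T, plant A x e = true) →
              t < #(T.filter fun e : (⊤ : SimpleGraph (Fin n)).edgeSet => ∀ v ∈ (e : Sym2 (Fin n)), v ∈ A)) ∧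
        ∀ S ∈ 𝓒, (∀ e ∈ S, (¬ ∀ v ∈ (e : Sym2 (Fin n)), v ∈ A) → x e = false) →
          #(S.filter fun e : (⊤ : SimpleGraph (Fin n)).edgeSet => ∀ v ∈ (e : Sym2 (Fin n)), v ∈ A) ≤ r) ≤
      2 ^ (m' * r) * #(univ.filter fun x : EdgeVec n =>
        (∀ S ∈ 𝓒, ∃ e ∈ S, plant A x e = true) ∧
          ∃ 𝓕 : Finset (Finset (⊤ : SimpleGraph (Fin n)).edgeSet), 𝓕 ⊆ 𝓒 ∧ #𝓕 = m' ∧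
            (∀ S ∈ 𝓕, ∀ e ∈ S, x e = false) ∧
            ∀ S ∈ 𝓕, ∀ S' ∈ 𝓕, S ≠ S' →
              Disjoint (S.filter fun e : (⊤ : SimpleGraph (Fin n)).edgeSet => ∀ v ∈ (e : Sym2 (Fin n)), v ∈ A)
                (S'.filter fun e : (⊤ : SimpleGraph (Fin n)).edgeSet => ∀ v ∈ (e : Sym2 (Fin n)), v ∈ A)) := by
  classical
  -- shorthands
  set ins : Finset (⊤ : SimpleGraph (Fin n)).edgeSet → Finset (⊤ : SimpleGraph (Fin n)).edgeSet :=
    fun S => S.filter fun e : (⊤ : SimpleGraph (Fin n)).edgeSet => ∀ v ∈ (e : Sym2 (Fin n)), v ∈ A with hins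
  set Hp : EdgeVec n → Prop := fun x =>
    ((∀ S ∈ 𝓒, ∃ e ∈ S, plant A x e = true) ∧
      ∀ T : Finset (⊤ : SimpleGraph (Fin n)).edgeSet, (∀ S ∈ 𝓒, ∃ e ∈ S, e ∈ T) →
        (∀ e ∈ T, plant A x e = true) → t < #(ins T)) ∧
    ∀ S ∈ 𝓒, (∀ e ∈ S, (¬ ∀ v ∈ (e : Sym2 (Fin n)), v ∈ A) → x e = false) → #(ins S) ≤ r with hHp
  set Ep : EdgeVec n → Prop := fun x =>
    (∀ S ∈ 𝓒, ∃ e ∈ S, plant A x e = true) ∧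
      ∃ 𝓕 : Finset (Finset (⊤ : SimpleGraph (Fin n)).edgeSet), 𝓕 ⊆ 𝓒 ∧ #𝓕 = m' ∧
        (∀ S ∈ 𝓕, ∀ e ∈ S, x e = false) ∧
        ∀ S ∈ 𝓕, ∀ S' ∈ 𝓕, S ≠ S' → Disjoint (ins S) (ins S') with hEp
  set Ω := univ.filter fun x : EdgeVec n => Hp x with hΩ
  set E' := univ.filter fun x : EdgeVec n => Ep x with hE'
  change #Ω ≤ 2 ^ (m' * r) * #E'
  -- erase the inside of `A`
  set er : EdgeVec n → EdgeVec n := fun x e => if ∀ v ∈ (e : Sym2 (Fin n)), v ∈ A then false else x e with her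
  have her_off : ∀ (x : EdgeVec n) (e : (⊤ : SimpleGraph (Fin n)).edgeSet),
      (¬ ∀ v ∈ (e : Sym2 (Fin n)), v ∈ A) → er x e = x e := fun x e he => by
    simp only [her]; rw [if_neg he]
  have her_on : ∀ (x : EdgeVec n) (e : (⊤ : SimpleGraph (Fin n)).edgeSet),
      (∀ v ∈ (e : Sym2 (Fin n)), v ∈ A) → er x e = false := fun x e he => by
    simp only [her]; rw [if_pos he]
  have hplant_er : ∀ x, plant A (er x) = plant A x := fun x =>
    plant_eq_of_eq_off_inside A fun e he => her_off x e he
  -- `Hp` is saturated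
  have hsat_er : ∀ x, Hp x → Hp (er x) := by
    intro x hx
    rw [hHp] at hx ⊢
    refine ⟨?_, fun S hS hresc => hx.2 S hS fun e he heA => ?_⟩
    · simpa only [hplant_er x] using hx.1
    · rw [← her_off x e heA]; exact hresc e he heA
  -- fibrewise over `er`
  rw [card_eq_sum_card_fiberwise (f := er) (s := Ω) (t := (univ : Finset (EdgeVec n))) fun _ _ => mem_univ _,
    card_eq_sum_card_fiberwise (f := er) (s := E') (t := (univ : Finset (EdgeVec n))) fun _ _ => mem_univ _,
    mul_sum]
  refine sum_le_sum fun z _ => ?_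
  by_cases hΩz : (Ω.filter fun x => er x = z) = ∅
  · rw [hΩz, card_empty]; exact Nat.zero_le _
  obtain ⟨x₀, hx₀⟩ := nonempty_iff_ne_empty.2 hΩz
  rw [mem_filter, hΩ, mem_filter] at hx₀
  obtain ⟨⟨-, hx₀H⟩, hx₀z⟩ := hx₀
  -- `z` itself lies in `Ω`
  have hzH : Hp z := by rw [← hx₀z]; exact hsat_er x₀ hx₀H
  have hzH' := hzH
  rw [hHp] at hzH'
  obtain ⟨⟨hsat, hheavy⟩, hG⟩ := hzH'
  -- the disjoint parts for `z`
  obtain ⟨𝓕, h𝓕𝓒, h𝓕card, h𝓕resc, -, h𝓕disj⟩ :=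
    depth3_disjoint_parts A 𝓒 z t r hsat hheavy hG m' hmr
  set D := 𝓕.biUnion ins with hD
  have hDins : ∀ e ∈ D, ∀ v ∈ (e : Sym2 (Fin n)), v ∈ A := by
    intro e he
    rw [hD, mem_biUnion] at he
    obtain ⟨S, -, heS⟩ := he
    rw [hins] at heS
    exact (mem_filter.1 heS).2
  have hDcard : #D ≤ m' * r := by
    calc #D ≤ ∑ S ∈ 𝓕, #(ins S) := card_biUnion_le
      _ ≤ ∑ _S ∈ 𝓕, r := sum_le_sum fun S hS => hG S (h𝓕𝓒 hS) (h𝓕resc S hS)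
      _ = m' * r := by rw [sum_const, smul_eq_mul, h𝓕card]
  -- the fibre and the map switching `D` off
  set Fib := univ.filter fun x : EdgeVec n => er x = z with hFib
  let φ : EdgeVec n → EdgeVec n := fun x e => if e ∈ D then false else x e
  have hφ_off : ∀ x e, e ∉ D → φ x e = x e := fun x e he => by simp [φ, he]
  have hφ_on : ∀ x e, e ∈ D → φ x e = false := fun x e he => by simp [φ, he]
  have her_φ : ∀ x, er (φ x) = er x := by
    intro x
    funext e
    by_cases he : ∀ v ∈ (e : Sym2 (Fin n)), v ∈ A
    · rw [her_on _ e he, her_on _ e he]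
    · have heD : e ∉ D := fun h => he (hDins e h)
      rw [her_off _ e he, her_off _ e he, hφ_off x e heD]
  have hplant_φ : ∀ x, plant A (φ x) = plant A x := fun x =>
    plant_eq_of_eq_off_inside A fun e he => hφ_off x e fun h => he (hDins e h)
  have hφE : ∀ x ∈ Fib, φ x ∈ E'.filter fun x => er x = z := by
    intro x hx
    rw [hFib, mem_filter] at hx
    rw [mem_filter, hE', mem_filter, her_φ x]
    refine ⟨⟨mem_univ _, ?_⟩, hx.2⟩
    rw [hEp]
    refine ⟨?_, 𝓕, h𝓕𝓒, h𝓕card, fun S hS e he => ?_, h𝓕disj⟩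
    · -- acceptance of the planted graph is read off `z`
      have h1 : plant A (φ x) = plant A z := by rw [hplant_φ x, ← hplant_er x, hx.2]
      simpa only [h1] using hsat
    · by_cases heA : ∀ v ∈ (e : Sym2 (Fin n)), v ∈ A
      · refine hφ_on x e ?_
        rw [hD, mem_biUnion]
        exact ⟨S, hS, by rw [hins]; exact mem_filter.2 ⟨he, heA⟩⟩
      · have heD : e ∉ D := fun h => heA (hDins e h)
        rw [hφ_off x e heD, ← her_off x e heA, hx.2]
        exact h𝓕resc S hS e he heA
  have himage : Fib.image φ ⊆ E'.filter fun x => er x = z := by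
    intro y hy
    rw [mem_image] at hy
    obtain ⟨x, hx, rfl⟩ := hy
    exact hφE x hx
  have hfibre : ∀ y ∈ Fib.image φ, #(Fib.filter fun x => φ x = y) ≤ 2 ^ (m' * r) := by
    intro y _
    calc #(Fib.filter fun x => φ x = y)
        ≤ #(univ.filter fun x : EdgeVec n => ∀ e, e ∉ D → x e = y e) := by
          refine card_le_card fun x hx => ?_
          rw [mem_filter] at hx
          rw [mem_filter]
          refine ⟨mem_univ _, fun e he => ?_⟩
          rw [← hx.2, hφ_off x e he]
      _ ≤ 2 ^ #D := card_filter_eq_off_le D y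
      _ ≤ 2 ^ (m' * r) := Nat.pow_le_pow_right two_pos hDcard
  calc #(Ω.filter fun x => er x = z)
      ≤ #Fib := card_le_card fun x hx => by
          rw [mem_filter] at hx; rw [hFib, mem_filter]; exact ⟨mem_univ _, hx.2⟩
    _ ≤ 2 ^ (m' * r) * #(Fib.image φ) := card_le_mul_card_image _ _ hfibre
    _ ≤ 2 ^ (m' * r) * #(E'.filter fun x => er x = z) := Nat.mul_le_mul_left _ (card_le_card himage)

/-! ### From `E'` to a large minimal touching set inside `A` -/

/-- **On `E'(A,x)` the planted set contains a large minimal touching set.** Let `𝒲` be the clauses of `𝓒` that are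
off in `x`, `τ` the touching predicate of `𝒲` and `𝓜` its minimal touching sets. If the CNF of `𝓒` accepts
`plant A x` and `m'` clauses off in `x` have pairwise disjoint inside-`A` parts, then `A` contains some `Z ∈ 𝓜` with
`z₀ ≤ #Z`, as soon as `C(z₀ - 1, 2) < m'`. [folklore] -/
theorem depth3_exists_minimal_of_white_parts (A : Finset (Fin n))
    (𝓒 : Finset (Finset (⊤ : SimpleGraph (Fin n)).edgeSet)) (x : EdgeVec n) (m' z₀ : ℕ)
    (hz₀ : (z₀ - 1).choose 2 < m')
    (τ : Finset (Fin n) → Prop)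
    (hτ : ∀ Z, τ Z ↔ ∀ S ∈ 𝓒.filter (fun S => ∀ e ∈ S, x e = false), ∃ e ∈ S, ∀ v ∈ (e : Sym2 (Fin n)), v ∈ Z)
    (𝓜 : Finset (Finset (Fin n))) (h𝓜 : ∀ Z, Z ∈ 𝓜 ↔ τ Z ∧ ∀ v ∈ Z, ¬ τ (Z.erase v))
    (hsat : ∀ S ∈ 𝓒, ∃ e ∈ S, plant A x e = true)
    (𝓕 : Finset (Finset (⊤ : SimpleGraph (Fin n)).edgeSet)) (h𝓕𝓒 : 𝓕 ⊆ 𝓒) (h𝓕card : #𝓕 = m')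
    (h𝓕off : ∀ S ∈ 𝓕, ∀ e ∈ S, x e = false)
    (h𝓕disj : ∀ S ∈ 𝓕, ∀ S' ∈ 𝓕, S ≠ S' →
      Disjoint (S.filter fun e : (⊤ : SimpleGraph (Fin n)).edgeSet => ∀ v ∈ (e : Sym2 (Fin n)), v ∈ A)
        (S'.filter fun e : (⊤ : SimpleGraph (Fin n)).edgeSet => ∀ v ∈ (e : Sym2 (Fin n)), v ∈ A)) :
    ∃ Z ∈ 𝓜, z₀ ≤ #Z ∧ Z ⊆ A := by
  classical
  -- `A` is touching
  have hA : τ A := by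
    rw [hτ]
    intro S hS
    rw [mem_filter] at hS
    obtain ⟨e, he, hey⟩ := hsat S hS.1
    refine ⟨e, he, ?_⟩
    by_contra heA
    rw [plant_apply_of_not_inside A x e heA, hS.2 e he] at hey
    exact Bool.false_ne_true hey
  obtain ⟨Z, hZ𝓜, hZA⟩ := depth3_exists_minimal_touching τ 𝓜 h𝓜 hA
  refine ⟨Z, hZ𝓜, ?_, hZA⟩
  -- every touching subset of `A` spans `≥ m'` slots
  have h𝓕W : 𝓕 ⊆ 𝓒.filter (fun S => ∀ e ∈ S, x e = false) := fun S hS =>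
    mem_filter.2 ⟨h𝓕𝓒 hS, h𝓕off S hS⟩
  have hch := depth3_choose_card_ge_of_disjoint_parts _ τ hτ hZA ((h𝓜 Z).1 hZ𝓜).1 𝓕 h𝓕W h𝓕disj
  rw [h𝓕card] at hch
  by_contra hlt
  have hle : #Z ≤ z₀ - 1 := by omega
  exact absurd (hch.trans (Nat.choose_le_choose 2 hle)) (not_le.2 hz₀)

/-! ### Registered form -/

open Classical in
/-- **stub_depth3Resample** (registered side result of stmt-PneNP-18027, depth-3 line of seat 0; NOT a stub of the
picked line's composition). [folklore] -/
theorem stub_depth3Resample : ∀ (n : ℕ) (A : Finset (Fin n)) (𝓒 : Finset (Finset ((⊤ : SimpleGraph (Fin n)).edgeSet))) (t r m' : ℕ), m' * r ≤ t + r → (Finset.univ.filter fun x : EdgeVec n => ((∀ S ∈ 𝓒, ∃ e ∈ S, plant A x e = true) ∧ ∀ T : Finset ((⊤ : SimpleGraph (Fin n)).edgeSet), (∀ S ∈ 𝓒, ∃ e ∈ S, e ∈ T) → (∀ e ∈ T, plant A x e = true) → t < (T.filter fun e : ((⊤ : SimpleGraph (Fin n)).edgeSet) => ∀ v ∈ (e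 : Sym2 (Fin n)), v ∈ A).card) ∧ ∀ S ∈ 𝓒, (∀ e ∈ S, (¬ ∀ v ∈ (e : Sym2 (Fin n)), v ∈ A) → x e = false) → (S.filter fun e : ((⊤ : SimpleGraph (Fin n)).edgeSet) => ∀ v ∈ (e : Sym2 (Fin n)), v ∈ A).card ≤ r).card ≤ 2 ^ (m' * r) * (Finset.univ.filter fun x : EdgeVec n => (∀ S ∈ 𝓒, ∃ e ∈ S, plant A x e = true) ∧ ∃ 𝓕 : Finset (Finset ((⊤ : SimpleGraph (Fin n)).edgeSet)), 𝓕 ⊆ 𝓒 ∧ 𝓕.card = m' ∧ (∀ S ∈ 𝓕, ∀ e ∈ S, x e = false) ∧ ∀ S ∈ 𝓕, ∀ S' ∈ 𝓕, S ≠ S' → Disjoint (S.filter fun e : ((⊤ : SimpleGraph (Fin n)).edgeSet) => ∀ v ∈ (e : Sym2 (Fin n)), v ∈ A) (S'.filter fun e : ((⊤ : SimpleGraph (Fin n)).edgeSet) => ∀ v ∈ (e : Sym2 (Fin n)), v ∈ A)).card :=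
  fun _ A 𝓒 t r m' hmr => depth3_resample_count A 𝓒 t r m' hmr

end Summit.PneNP.PneNP.Theorems
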